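import Literature.NumberTheory.Automorphic.SmoothKernelGLArchParametricIntegral
import Literature.NumberTheory.Automorphic.UnitaryGroupHeisenbergKAverageSchwartzBruhat
import Literature.NumberTheory.Automorphic.UnitaryGroupHeisenbergConjThreeFactor
import Literature.NumberTheory.Automorphic.UnitaryGroupTruncatedKernelIntegrableOfCusp
import Literature.NumberTheory.Automorphic.AutomorphicTwistHecke
import Literature.NumberTheory.Automorphic.AdelicSecondCountable
import Mathlib.Topology.Instances.RealVectorSpace
import Mathlib.MeasureTheory.Integral.Prod
import HarnessLib

/-!
# The Heisenberg fibre integral of the `K`-average of a test function on `U(J₃)(𝔸_F)` is smooth in the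
# archimedean variable, hence `ψ(x₀) = ∫_{𝔸_E⁻} ∫_K f(k⁻¹ z₁ u(x₀, w) k) dk dw ∈ 𝒮(𝔸_E)` unconditionally
(Rogawski, *Automorphic Representations of Unitary Groups in Three Variables* (1990), §7.3 pp. 96–97: the function `ψ` of the
unipotent term (7.3.3) is a Schwartz–Bruhat function on `𝔸_E`; Weil, *Basic Number Theory*, Ch. VII §2; Hörmander, Thm. 1.1.9)

Topic `NumberTheory/Automorphic`; namespace `Literature.NumberTheory.Automorphic.UnitaryGroup`. THEOREMS ONLY over accepted tree
modules (no definition, no named fact, no instance, no notation, no `sorry`). Row (L5-i)(E3-pre)(c) of the LAW 5 road of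
`Cruxes/H413/Lines/F0_T1InnerFormTraceIdentity.lean` (cell `pub/hodgecm-mathlib`, crux H413): the archimedean-smoothness clause `hsm` of
★ `integral_kAverage_heisChart_mem_schwartzBruhatAdele_of_contDiff` (`UnitaryGroupHeisenbergKAverageSchwartzBruhat`), DISCHARGED.

Letters: `G = U(J₃)` quasi-split (`quasiSplit F E c 3`, `hc : c * c = 1`), `π = adelicVal : G(𝔸_F) ≤ GL₃(𝔸_E)`, the Heisenberg chart
★ `heisChart hc : 𝔸_E × 𝔸_E⁻ ≃ₜ N(𝔸_F)`, a compact subgroup `K ≤ G(𝔸_F)` with a finite Borel measure `μK`, an `s`-finite measure `μY`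
on `𝔸_E⁻` finite on compacts, `z₁ ∈ G(𝔸_F)`, and a test function `f ∈ C_c^∞(G(𝔸_F))` (★ `IsQuasiSplitTest`: `f = η ∘ π` with
`η = η₁ + iη₂` a smooth kernel on `GL₃(𝔸_E)`).

* §1 `isSmoothKernelGL_of_isTestFunctionGL_pair` — `η₁ + iη₂` is a smooth kernel (★ `IsSmoothKernelGL`) for test functions `η₁, η₂` (generic `GL_n`).
* §2 **`contDiff_integral_integral_kAverage_heisChart`** — for every `y ∈ 𝔸_E^∞`,
  `x_∞ ↦ ∫_{𝔸_E⁻} ∫_K f(k⁻¹ z₁ u((x_∞, y), w) k) dμK dμY` is `C^∞` on `E_∞ = mixedSpace E`: EXACTLY the binder `hsm` of ★ p823269. Proof: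
  Fubini to the product measure `μY ⊗ μK` (★ `integral_prod`), then ★ `IsSmoothKernelGL.contDiff_integral_of_toMixed_eq`
  (`SmoothKernelGLArchParametricIntegral`, Hörmander 1.1.9) for the family `G (w,k) x = π(k⁻¹ z₁ u((x,y),w) k)`, whose archimedean
  part is `π(k⁻¹z₁)_∞ · (1 + xE₀₁ − C(x)E₁₂ + (w_∞ − ½ x C(x))E₀₂) · π(k)_∞` (★ `coe_toMixed_adelicVal` of H5b
  `UnitaryGroupHeisenbergConjThreeFactor`; `C` = the archimedean conjugation, a real-linear map of `E_∞`) — one polynomial map of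
  `(π(k⁻¹z₁)_∞, π(k)_∞, w_∞; x)` — and whose supports are uniformly compact (`tsupport f` compact, `K` compact, `N(𝔸_F)` closed, the chart
  a homeomorphism; the pattern of ★ `exists_isCompact_kAverage_ne_zero`).
* §3 **`integral_kAverage_heisChart_mem_schwartzBruhatAdele`** — `ψ ∈ Meyer.schwartzBruhatAdele E` for every test function `f`,
  UNCONDITIONALLY: §2 + the support ∕ level ∕ criterion bricks of ★ p823269 (`exists_isCompact_kAverage_ne_zero`, the tube lemma
  `exists_levelIdeal_forall_conj_heisChart_mem` applied to the OPEN set `{v | π(v)_f ∈ U₀}`, `kAverage_mul_eq_of_forall_conj_mem` applied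
  to the LEVEL `{v | π v ∈ {1} × U₀}` — the conjugates `k⁻¹ u((0,δ),0) k` have trivial archimedean part —, ★
  `integral_heisChart_mem_schwartzBruhatAdele_of_contDiff`).

## References

* J. D. Rogawski, *Automorphic Representations of Unitary Groups in Three Variables*, Ann. of Math. Stud. 123 (1990), §7.3
  (pp. 96–97) [Rogawski1990].
* A. Weil, *Basic Number Theory*, Grundlehren 144 (1967), Ch. VII §2 [WeilBNT1967].
* L. Hörmander, *The Analysis of Linear Partial Differential Operators I*, Grundlehren 256 (1983), Thm. 1.1.9 [HormanderALPDO1].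
* A. Borel, H. Jacquet, *Automorphic forms and automorphic representations*, Proc. Sympos. Pure Math. 33 (1979), §4.1 [BorelJacquet1979].
-/

set_option autoImplicit false

noncomputable section

open MeasureTheory NumberField NumberField.mixedEmbedding IsDedekindDomain Set Topology Filter Function
-- `Classical` is needed to see the Mathlib normed-space instances on `mixedSpace E` (note H5 of `AdelicGLnGlue`)
open scoped ContDiff Classical MatrixGroups Matrix

namespace Literature.NumberTheory.Automorphic

-- the Banach algebra structure of `M_n(K_∞)` through which `IsArchSmooth` is defined
open scoped Matrix.Norms.Operator

/-! ## §1 `η₁ + iη₂` is a smooth kernel -/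

section Pair

variable {n : ℕ} {K : Type} [Field K] [NumberField K]

/-- **The complex combination `η₁ + iη₂` of two test functions on `GL_n(𝔸_K)` is a smooth kernel** (archimedean smoothness,
compact support and a common admissible level, ★ `inf_mem_finiteLevelsGL`). [cite: BorelJacquet1979, §4.1] -/
theorem isSmoothKernelGL_of_isTestFunctionGL_pair {η₁ η₂ : GL (Fin n) (AdeleRing (𝓞 K) K) → ℝ}
    (h₁ : IsTestFunctionGL n K η₁) (h₂ : IsTestFunctionGL n K η₂) :
    IsSmoothKernelGL n K fun z => (η₁ z : ℂ) + (η₂ z : ℂ) * Complex.I := by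
  refine ⟨fun g => ?_, ?_, ?_⟩
  · exact (h₁.isSmoothKernelGL.isArchSmooth g).add ((h₂.isSmoothKernelGL.isArchSmooth g).mul contDiff_const)
  · exact h₁.isSmoothKernelGL.hasCompactSupport.add h₂.isSmoothKernelGL.hasCompactSupport.mul_right
  · obtain ⟨U₁, hU₁, hi₁⟩ := h₁.isSmoothKernelGL.exists_level
    obtain ⟨U₂, hU₂, hi₂⟩ := h₂.isSmoothKernelGL.exists_level
    refine ⟨U₁ ⊓ U₂, inf_mem_finiteLevelsGL hU₁ hU₂, fun u hu z => ?_⟩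
    have e₁ : (η₁ (z * u) : ℂ) = η₁ z := hi₁ u (Subgroup.mem_inf.1 hu).1 z
    have e₂ : (η₂ (z * u) : ℂ) = η₂ z := hi₂ u (Subgroup.mem_inf.1 hu).2 z
    show (η₁ (z * u) : ℂ) + (η₂ (z * u) : ℂ) * Complex.I = (η₁ z : ℂ) + (η₂ z : ℂ) * Complex.I
    rw [e₁, e₂]

end Pair

namespace UnitaryGroup

variable {F E : Type} [Field F] [NumberField F] [Field E] [NumberField E] [Algebra F E] {c : E ≃ₐ[F] E}

/-! ## §2 Archimedean smoothness of `x_∞ ↦ ∫_{𝔸_E⁻} ∫_K f(k⁻¹ z₁ u((x_∞, y), w) k) dμK dμY` -/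

section ArchSmooth

/-- `N(𝔸_F)` is closed in `G(𝔸_F)` (★ `isClosed_upperUnitriangular` pulled back along `adelicVal`; private plumbing, a copy of the
private lemma of ★ `UnitaryGroupHeisenbergKAverageSchwartzBruhat`). [cite: Rogawski1990, §1.10] -/
private theorem isClosed_adelicUnipotent_quasiSplit₃' :
    IsClosed ((adelicUnipotent F E c 3 : Set (quasiSplit F E c 3).Adelic)) := by
  haveI : T2Space (AdeleRing (𝓞 E) E) := t2Space_adeleRing E
  change IsClosed (⇑(adelicVal F E c 3 ((StdForm.antidiagonal 3).over E)) ⁻¹'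
    ((upperUnitriangular (Fin 3) (AdeleRing (𝓞 E) E) : Subgroup (GL (Fin 3) (AdeleRing (𝓞 E) E))) :
      Set (GL (Fin 3) (AdeleRing (𝓞 E) E))))
  exact (isClosed_upperUnitriangular (R := AdeleRing (𝓞 E) E)).preimage continuous_subtype_val

/-- **The archimedean part of a Heisenberg element with archimedean coordinate `x_∞`** (★ `coe_toMixed_adelicVal`):
`π(u((x_∞, y), w))_∞ = 1 + x_∞E₀₁ − C(x_∞)E₁₂ + (w_∞ − ½_∞ x_∞ C(x_∞))E₀₂`, where `C(x_∞) = (c(x_∞, y))_∞` and `w_∞`, `½_∞` are the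
archimedean readings (★ `archHom`). [cite: Rogawski1990, §1.10] -/
theorem coe_toMixed_adelicVal_heisChart (hc : c * c = 1) (x : mixedSpace E) (y : FiniteAdeleRing (𝓞 E) E) (w : traceZeroAdele F E c) :
    ((GLn.toMixed 3 E (adelicVal F E c 3 _ (heisChart hc ((((InfiniteAdeleRing.ringEquiv_mixedSpace E).symm x, y) : AdeleRing (𝓞 E) E), w) :
        (quasiSplit F E c 3).Adelic)) : GL (Fin 3) (mixedSpace E)) : Matrix (Fin 3) (Fin 3) (mixedSpace E)) =
      1 + Matrix.single 0 1 x +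
        Matrix.single 1 2 (-(archHom E (conjAdele F E c (((InfiniteAdeleRing.ringEquiv_mixedSpace E).symm x, y) : AdeleRing (𝓞 E) E)))) +
        Matrix.single 0 2 (archHom E (w : AdeleRing (𝓞 E) E) - archHom E halfAdele *
          (x * archHom E (conjAdele F E c (((InfiniteAdeleRing.ringEquiv_mixedSpace E).symm x, y) : AdeleRing (𝓞 E) E)))) := by
  have hx : archHom E ((((InfiniteAdeleRing.ringEquiv_mixedSpace E).symm x, y) : AdeleRing (𝓞 E) E)) = x := by
    rw [archHom_apply]
    exact (InfiniteAdeleRing.ringEquiv_mixedSpace E).apply_symm_apply x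
  simp only [coe_toMixed_adelicVal hc, coordX_heisChart, coordY_heisChart, map_neg, heisZ, map_sub, map_mul, hx]

/-- The Heisenberg element `u((0, δ), 0)` (`δ ∈ 𝔸_E^∞`) has trivial archimedean part: `π(u((0,δ),0))_∞ = 1`
(★ `coe_toMixed_adelicVal`: all three archimedean readings vanish). [cite: Rogawski1990, §1.10] -/
theorem toMixed_adelicVal_heisChart_finite (hc : c * c = 1) (δ : FiniteAdeleRing (𝓞 E) E) :
    GLn.toMixed 3 E (adelicVal F E c 3 _ (heisChart hc ((((0 : InfiniteAdeleRing E), δ) : AdeleRing (𝓞 E) E), (0 : traceZeroAdele F E c)) :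
      (quasiSplit F E c 3).Adelic)) = 1 := by
  have h0 : archHom E ((((0 : InfiniteAdeleRing E), δ) : AdeleRing (𝓞 E) E)) = 0 := by
    rw [archHom_apply]
    exact map_zero _
  have hc0 : archHom E (conjAdele F E c ((((0 : InfiniteAdeleRing E), δ) : AdeleRing (𝓞 E) E))) = 0 := by
    show InfiniteAdeleRing.ringEquiv_mixedSpace E (c • (0 : InfiniteAdeleRing E)) = 0
    rw [smul_zero, map_zero]
  refine Units.ext ?_
  simp only [coe_toMixed_adelicVal hc, coordX_heisChart, coordY_heisChart, map_neg, heisZ, map_sub, map_mul, h0, hc0,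
    ZeroMemClass.coe_zero, map_zero, neg_zero, mul_zero, sub_zero, Matrix.single_zero, add_zero, Units.val_one]

variable [MeasurableSpace (traceZeroAdele F E c)] [BorelSpace (traceZeroAdele F E c)]
  {KU : Subgroup (quasiSplit F E c 3).Adelic} [MeasurableSpace KU] [BorelSpace KU]

/-- **ARCHIMEDEAN SMOOTHNESS OF THE HEISENBERG FIBRE INTEGRAL OF THE `K`-AVERAGE OF A SMOOTH KERNEL.** Let `f = η ∘ π` on `G(𝔸_F)`
for a smooth kernel `η` on `GL₃(𝔸_E)` (★ `IsSmoothKernelGL`), `K ≤ G(𝔸_F)` compact with a finite Borel measure `μK`, `μY` an `s`-finite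
measure on `𝔸_E⁻` finite on compacts, `z₁ ∈ G(𝔸_F)`, `y ∈ 𝔸_E^∞`. Then `x_∞ ↦ ∫_{𝔸_E⁻} ∫_K f(k⁻¹ z₁ u((x_∞, y), w) k) dμK dμY` is `C^∞`
on `E_∞`. Proof: Fubini (★ `integral_prod`; the integrand is continuous of compact support on `𝔸_E⁻ × K`), then ★
`IsSmoothKernelGL.contDiff_integral_of_toMixed_eq` for `G (w, k) x = π(k⁻¹ z₁ u((x, y), w) k)`, whose archimedean part is the polynomial
`π(k⁻¹z₁)_∞ (1 + xE₀₁ − C(x)E₁₂ + (w_∞ − ½ x C(x))E₀₂) π(k)_∞` in `x` (`coe_toMixed_adelicVal_heisChart`) and whose supports are uniformly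
compact. [cite: Rogawski1990, §7.3 (pp. 96–97)] [cite: HormanderALPDO1, Thm. 1.1.9] -/
theorem contDiff_integral_integral_kAverage_heisChart_of_isSmoothKernelGL (hc : c * c = 1) (μY : Measure (traceZeroAdele F E c))
    [SFinite μY] [IsFiniteMeasureOnCompacts μY] (hK : IsCompact (KU : Set (quasiSplit F E c 3).Adelic)) (μK : Measure KU)
    [IsFiniteMeasure μK] (z₁ : (quasiSplit F E c 3).Adelic) {f : (quasiSplit F E c 3).Adelic → ℂ}
    {η : GL (Fin 3) (AdeleRing (𝓞 E) E) → ℂ} (hη : IsSmoothKernelGL 3 E η) (hfη : ∀ g, f g = η (adelicVal F E c 3 _ g))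
    (y : FiniteAdeleRing (𝓞 E) E) :
    ContDiff ℝ ∞ fun x : mixedSpace E =>
      ∫ w, (∫ k, f ((k : (quasiSplit F E c 3).Adelic)⁻¹ * z₁ *
        (heisChart hc ((((InfiniteAdeleRing.ringEquiv_mixedSpace E).symm x, y) : AdeleRing (𝓞 E) E), w) : (quasiSplit F E c 3).Adelic) * k) ∂μK) ∂μY := by
  haveI : T2Space (AdeleRing (𝓞 E) E) := t2Space_adeleRing E
  haveI : SecondCountableTopology (AdeleRing (𝓞 E) E) := secondCountableTopology_adeleRing E
  haveI : SecondCountableTopology (GL (Fin 3) (AdeleRing (𝓞 E) E)) := secondCountableTopology_generalLinearGroup_adeleRing E (Fin 3)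
  haveI : SecondCountableTopology (quasiSplit F E c 3).Adelic :=
    inferInstanceAs (SecondCountableTopology (adelic F E c 3 ((StdForm.antidiagonal 3).over E)))
  -- subgroups coerced to types are not syntactically `↥(s : Set _)`: install second countability by hand
  haveI : SecondCountableTopology (traceZeroAdele F E c) := TopologicalSpace.Subtype.secondCountableTopology _
  haveI : SecondCountableTopology KU := TopologicalSpace.Subtype.secondCountableTopology _
  haveI : CompactSpace KU := isCompact_iff_compactSpace.1 hK
  -- the family `G (w, k) x = π(k⁻¹ z₁ u((x, y), w) k)`
  set G : traceZeroAdele F E c × KU → mixedSpace E → GL (Fin 3) (AdeleRing (𝓞 E) E) := fun p x =>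
    adelicVal F E c 3 _ (((p.2 : (quasiSplit F E c 3).Adelic))⁻¹ * z₁ *
      (heisChart hc ((((InfiniteAdeleRing.ringEquiv_mixedSpace E).symm x, y) : AdeleRing (𝓞 E) E), p.1) : (quasiSplit F E c 3).Adelic) *
        (p.2 : (quasiSplit F E c 3).Adelic)) with hGdef
  have hGc : Continuous (Function.uncurry G) := by
    refine continuous_subtype_val.comp ((((continuous_subtype_val.comp (continuous_snd.comp continuous_fst)).inv.mul
      continuous_const).mul (continuous_subtype_val.comp ((heisChart hc).continuous.comp ?_))).mul
      (continuous_subtype_val.comp (continuous_snd.comp continuous_fst)))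
    exact (((continuous_ringEquiv_mixedSpace_symm E).comp continuous_snd).prodMk continuous_const).prodMk
      (continuous_fst.comp continuous_fst)
  -- the archimedean conjugation `C(x) = (c x)_∞`, a continuous real-linear map of `E_∞`
  set Cadd : mixedSpace E →+ mixedSpace E :=
    { toFun := fun x => InfiniteAdeleRing.ringEquiv_mixedSpace E (c • (InfiniteAdeleRing.ringEquiv_mixedSpace E).symm x)
      map_zero' := by
        show InfiniteAdeleRing.ringEquiv_mixedSpace E (c • (InfiniteAdeleRing.ringEquiv_mixedSpace E).symm 0) = 0
        rw [map_zero, smul_zero, map_zero]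
      map_add' := fun a b => by
        show InfiniteAdeleRing.ringEquiv_mixedSpace E (c • (InfiniteAdeleRing.ringEquiv_mixedSpace E).symm (a + b)) =
          InfiniteAdeleRing.ringEquiv_mixedSpace E (c • (InfiniteAdeleRing.ringEquiv_mixedSpace E).symm a) +
            InfiniteAdeleRing.ringEquiv_mixedSpace E (c • (InfiniteAdeleRing.ringEquiv_mixedSpace E).symm b)
        rw [map_add, smul_add, map_add] } with hCadd
  have hCc : Continuous Cadd := (continuous_ringEquiv_mixedSpace E).comp
    ((InfiniteAdeleRing.continuous_smul F c).comp (continuous_ringEquiv_mixedSpace_symm E))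
  set C : mixedSpace E →L[ℝ] mixedSpace E := Cadd.toRealLinearMap hCc with hCdef
  have hCx : ∀ x : mixedSpace E, archHom E (conjAdele F E c ((((InfiniteAdeleRing.ringEquiv_mixedSpace E).symm x, y) : AdeleRing (𝓞 E) E))) = C x := fun x => rfl
  -- the elementary matrices as continuous real-linear maps of the entry
  have hsingle : ∀ i j : Fin 3, ContDiff ℝ ∞ fun a : mixedSpace E => Matrix.single i j a := fun i j => by
    set ℓ : mixedSpace E →ₗ[ℝ] Matrix (Fin 3) (Fin 3) (mixedSpace E) :=
      { toFun := fun a => Matrix.single i j a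
        map_add' := Matrix.single_add i j
        map_smul' := fun r a => (Matrix.smul_single r i j a).symm } with hℓ
    exact ℓ.toContinuousLinearMap.contDiff
  -- the polynomial `M ((P, (Q, ω)), x) = P (1 + xE₀₁ − C(x)E₁₂ + (ω − ½ x C(x))E₀₂) Q`
  set M : (Matrix (Fin 3) (Fin 3) (mixedSpace E) × (Matrix (Fin 3) (Fin 3) (mixedSpace E) × mixedSpace E)) × mixedSpace E →
      Matrix (Fin 3) (Fin 3) (mixedSpace E) := fun q =>
    q.1.1 * (1 + Matrix.single 0 1 q.2 + Matrix.single 1 2 (-(C q.2)) +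
      Matrix.single 0 2 (q.1.2.2 - archHom E (halfAdele : AdeleRing (𝓞 E) E) * (q.2 * C q.2))) * q.1.2.1 with hMdef
  have hMs : ContDiff ℝ ∞ M := by
    have h2 : ContDiff ℝ ∞ fun q : (Matrix (Fin 3) (Fin 3) (mixedSpace E) × (Matrix (Fin 3) (Fin 3) (mixedSpace E) × mixedSpace E)) ×
        mixedSpace E => q.2 := contDiff_snd
    have hC2 : ContDiff ℝ ∞ fun q : (Matrix (Fin 3) (Fin 3) (mixedSpace E) × (Matrix (Fin 3) (Fin 3) (mixedSpace E) × mixedSpace E)) ×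
        mixedSpace E => C q.2 := C.contDiff.comp contDiff_snd
    refine ((contDiff_fst.comp contDiff_fst).mul (((contDiff_const.add ((hsingle 0 1).comp h2)).add
      ((hsingle 1 2).comp hC2.neg)).add ((hsingle 0 2).comp ?_))).mul (contDiff_fst.comp (contDiff_snd.comp contDiff_fst))
    exact ((contDiff_snd.comp (contDiff_snd.comp contDiff_fst))).sub (contDiff_const.mul (h2.mul hC2))
  -- the continuous parameters `α (w, k) = (π(k⁻¹z₁)_∞, π(k)_∞, w_∞)`
  set α : traceZeroAdele F E c × KU →
      Matrix (Fin 3) (Fin 3) (mixedSpace E) × (Matrix (Fin 3) (Fin 3) (mixedSpace E) × mixedSpace E) := fun p =>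
    (((GLn.toMixed 3 E (adelicVal F E c 3 _ (((p.2 : (quasiSplit F E c 3).Adelic))⁻¹ * z₁)) : GL (Fin 3) (mixedSpace E)) :
        Matrix (Fin 3) (Fin 3) (mixedSpace E)),
      ((((GLn.toMixed 3 E (adelicVal F E c 3 _ (p.2 : (quasiSplit F E c 3).Adelic))) : GL (Fin 3) (mixedSpace E)) :
        Matrix (Fin 3) (Fin 3) (mixedSpace E)), archHom E (p.1 : AdeleRing (𝓞 E) E))) with hαdef
  have hαc : Continuous α := by
    have hA : Continuous (archHom E) := (continuous_ringEquiv_mixedSpace E).comp continuous_fst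
    refine (Units.continuous_val.comp ((GLn.continuous_toMixed 3 E).comp (continuous_subtype_val.comp
      ((continuous_subtype_val.comp continuous_snd).inv.mul continuous_const)))).prodMk
      ((Units.continuous_val.comp ((GLn.continuous_toMixed 3 E).comp (continuous_subtype_val.comp
        (continuous_subtype_val.comp continuous_snd)))).prodMk (hA.comp (continuous_subtype_val.comp continuous_fst)))
  have hGM : ∀ p x, ((GLn.toMixed 3 E (G p x) : GL (Fin 3) (mixedSpace E)) : Matrix (Fin 3) (Fin 3) (mixedSpace E)) = M (α p, x) := by
    intro p x
    simp only [hGdef, hMdef, hαdef, map_mul, Units.val_mul, coe_toMixed_adelicVal_heisChart hc, hCx]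
  -- the uniform compact supports
  have hfc : HasCompactSupport f := by
    have h : f = η ∘ adelicVal F E c 3 _ := funext hfη
    rw [h]
    have hcl : IsClosed ((adelic F E c 3 ((StdForm.antidiagonal 3).over E) : Subgroup (GL (Fin 3) (AdeleRing (𝓞 E) E))) :
        Set (GL (Fin 3) (AdeleRing (𝓞 E) E))) := isClosed_unitaryGroupOfForm_conjAdele F E c _
    exact hη.hasCompactSupport.comp_isClosedEmbedding hcl.isClosedEmbedding_subtypeVal
  set S₀ : Set (quasiSplit F E c 3).Adelic :=
    (fun p : (quasiSplit F E c 3).Adelic × (quasiSplit F E c 3).Adelic => z₁⁻¹ * (p.1 * p.2 * p.1⁻¹)) ''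
      ((KU : Set (quasiSplit F E c 3).Adelic) ×ˢ tsupport f) with hS₀
  have hS₀c : IsCompact S₀ :=
    (hK.prod hfc.isCompact).image (continuous_const.mul ((continuous_fst.mul continuous_snd).mul continuous_fst.inv))
  set S₁ : Set (AdeleRing (𝓞 E) E × traceZeroAdele F E c) :=
    (heisChart hc).symm '' (Subtype.val ⁻¹' S₀) with hS₁
  have hS₁c : IsCompact S₁ :=
    ((isClosed_adelicUnipotent_quasiSplit₃'.isClosedEmbedding_subtypeVal).isCompact_preimage hS₀c).image (heisChart hc).symm.continuous
  have hmemS₁ : ∀ (p : traceZeroAdele F E c × KU) (x : mixedSpace E), η (G p x) ≠ 0 →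
      (((((InfiniteAdeleRing.ringEquiv_mixedSpace E).symm x, y) : AdeleRing (𝓞 E) E)), p.1) ∈ S₁ := by
    intro p x hne
    have hne' : f (((p.2 : (quasiSplit F E c 3).Adelic))⁻¹ * z₁ *
        (heisChart hc ((((InfiniteAdeleRing.ringEquiv_mixedSpace E).symm x, y) : AdeleRing (𝓞 E) E), p.1) : (quasiSplit F E c 3).Adelic) *
        (p.2 : (quasiSplit F E c 3).Adelic)) ≠ 0 := by
      rw [hfη]
      exact hne
    have hu : (heisChart hc ((((InfiniteAdeleRing.ringEquiv_mixedSpace E).symm x, y) : AdeleRing (𝓞 E) E), p.1) : (quasiSplit F E c 3).Adelic) ∈ S₀ := by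
      refine ⟨((p.2 : (quasiSplit F E c 3).Adelic), (p.2 : (quasiSplit F E c 3).Adelic)⁻¹ * z₁ *
        (heisChart hc ((((InfiniteAdeleRing.ringEquiv_mixedSpace E).symm x, y) : AdeleRing (𝓞 E) E), p.1) : (quasiSplit F E c 3).Adelic) *
        (p.2 : (quasiSplit F E c 3).Adelic)), ⟨p.2.2, subset_tsupport _ hne'⟩, ?_⟩
      show z₁⁻¹ * ((p.2 : (quasiSplit F E c 3).Adelic) * ((p.2 : (quasiSplit F E c 3).Adelic)⁻¹ * z₁ *
        (heisChart hc ((((InfiniteAdeleRing.ringEquiv_mixedSpace E).symm x, y) : AdeleRing (𝓞 E) E), p.1) : (quasiSplit F E c 3).Adelic) *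
        (p.2 : (quasiSplit F E c 3).Adelic)) *
        (p.2 : (quasiSplit F E c 3).Adelic)⁻¹) = _
      group
    exact ⟨heisChart hc ((((InfiniteAdeleRing.ringEquiv_mixedSpace E).symm x, y) : AdeleRing (𝓞 E) E), p.1), hu, (heisChart hc).symm_apply_apply _⟩
  set W_c : Set (traceZeroAdele F E c) := Prod.snd '' S₁ with hW_c
  have hW_cc : IsCompact W_c := hS₁c.image continuous_snd
  set P_c : Set (mixedSpace E) := (fun q : AdeleRing (𝓞 E) E × traceZeroAdele F E c => archHom E q.1) '' S₁ with hP_c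
  have hP_cc : IsCompact P_c := hS₁c.image (((continuous_ringEquiv_mixedSpace E).comp continuous_fst).comp continuous_fst)
  have hsupp : ∀ (p : traceZeroAdele F E c × KU) (x : mixedSpace E), η (G p x) ≠ 0 → p ∈ W_c ×ˢ (univ : Set KU) ∧ x ∈ P_c := by
    intro p x hne
    have h := hmemS₁ p x hne
    refine ⟨⟨⟨_, h, rfl⟩, mem_univ _⟩, ⟨_, h, ?_⟩⟩
    show archHom E ((((InfiniteAdeleRing.ringEquiv_mixedSpace E).symm x, y) : AdeleRing (𝓞 E) E)) = x
    rw [archHom_apply]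
    exact (InfiniteAdeleRing.ringEquiv_mixedSpace E).apply_symm_apply x
  have hA_c : IsCompact (W_c ×ˢ (univ : Set KU)) := hW_cc.prod isCompact_univ
  have hA_cm : MeasurableSet (W_c ×ˢ (univ : Set KU)) := hW_cc.isClosed.measurableSet.prod MeasurableSet.univ
  have hμA : (μY.prod μK) (W_c ×ˢ (univ : Set KU)) < ⊤ := by
    rw [Measure.prod_prod]
    exact ENNReal.mul_lt_top hW_cc.measure_lt_top (measure_lt_top μK _)
  -- Fubini
  have hint : ∀ x : mixedSpace E, Integrable (fun p : traceZeroAdele F E c × KU => η (G p x)) (μY.prod μK) := fun x =>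
    (hη.continuous.comp (hGc.comp (continuous_id.prodMk continuous_const))).integrable_of_hasCompactSupport
      (HasCompactSupport.intro hA_c fun p hp => by
        by_contra hne
        exact hp (hsupp p x hne).1)
  have heq : (fun x : mixedSpace E => ∫ w, (∫ k, f ((k : (quasiSplit F E c 3).Adelic)⁻¹ * z₁ *
      (heisChart hc ((((InfiniteAdeleRing.ringEquiv_mixedSpace E).symm x, y) : AdeleRing (𝓞 E) E), w) : (quasiSplit F E c 3).Adelic) * k) ∂μK) ∂μY) =
      fun x => ∫ p, η (G p x) ∂(μY.prod μK) := by
    funext x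
    rw [integral_prod _ (hint x)]
    simp only [hGdef, hfη]
  rw [heq]
  exact hη.contDiff_integral_of_toMixed_eq hGc hαc hMs hGM hA_c hA_cm hμA hP_cc hsupp

/-- **ARCHIMEDEAN SMOOTHNESS FOR A TEST FUNCTION — the clause `hsm` of ★ `integral_kAverage_heisChart_mem_schwartzBruhatAdele_of_contDiff`,
DISCHARGED.** For `f ∈ C_c^∞(U(J₃)(𝔸_F))` (★ `IsQuasiSplitTest`), `K ≤ G(𝔸_F)` compact with a finite Borel measure `μK`, `μY` `s`-finite and
finite on compacts on `𝔸_E⁻`, `z₁ ∈ G(𝔸_F)` and `y ∈ 𝔸_E^∞`, the archimedean slice `x_∞ ↦ ∫_{𝔸_E⁻} ∫_K f(k⁻¹ z₁ u((x_∞, y), w) k) dμK dμY`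
is `C^∞` on `E_∞`. [cite: Rogawski1990, §7.3 (pp. 96–97)] [cite: HormanderALPDO1, Thm. 1.1.9] -/
theorem contDiff_integral_integral_kAverage_heisChart (hc : c * c = 1) (μY : Measure (traceZeroAdele F E c))
    [SFinite μY] [IsFiniteMeasureOnCompacts μY] (hK : IsCompact (KU : Set (quasiSplit F E c 3).Adelic)) (μK : Measure KU)
    [IsFiniteMeasure μK] (z₁ : (quasiSplit F E c 3).Adelic) {f : (quasiSplit F E c 3).Adelic → ℂ} (hf : IsQuasiSplitTest F E c 3 f)
    (y : FiniteAdeleRing (𝓞 E) E) :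
    ContDiff ℝ ∞ fun x : mixedSpace E =>
      ∫ w, (∫ k, f ((k : (quasiSplit F E c 3).Adelic)⁻¹ * z₁ *
        (heisChart hc ((((InfiniteAdeleRing.ringEquiv_mixedSpace E).symm x, y) : AdeleRing (𝓞 E) E), w) : (quasiSplit F E c 3).Adelic) * k) ∂μK) ∂μY := by
  obtain ⟨η₁, η₂, hη₁, hη₂, hfη⟩ := hf
  exact contDiff_integral_integral_kAverage_heisChart_of_isSmoothKernelGL hc μY hK μK z₁
    (isSmoothKernelGL_of_isTestFunctionGL_pair hη₁ hη₂) hfη y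

end ArchSmooth

/-! ## §3 `ψ ∈ 𝒮(𝔸_E)` for every test function, unconditionally -/

section Assembly

variable [MeasurableSpace (traceZeroAdele F E c)] [BorelSpace (traceZeroAdele F E c)]
  {KU : Subgroup (quasiSplit F E c 3).Adelic} [MeasurableSpace KU] [BorelSpace KU]

/-- **`ψ ∈ 𝒮(𝔸_E)`, UNCONDITIONALLY** (Rogawski (1990), §7.3 pp. 96–97: the function `ψ` of the unipotent term (7.3.3) is a
Schwartz–Bruhat function on `𝔸_E`). For a test function `f ∈ C_c^∞(U(J₃)(𝔸_F))` (★ `IsQuasiSplitTest`), a compact subgroup `K` with a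
finite Borel measure `μK`, any `z₁ ∈ G(𝔸_F)` and any left-invariant `s`-finite measure `μY` on `𝔸_E⁻` finite on compacts,
`ψ(x₀) := ∫_{𝔸_E⁻} ∫_K f(k⁻¹ z₁ u(x₀, w) k) dμK dμY ∈ Meyer.schwartzBruhatAdele E`. Composition of ★ p823269's bricks — support ★
`exists_isCompact_kAverage_ne_zero`; level: the tube lemma ★ `exists_levelIdeal_forall_conj_heisChart_mem` for the OPEN set `{v | π(v)_f ∈ U₀}`
and ★ `kAverage_mul_eq_of_forall_conj_mem` for the LEVEL `{v | π v ∈ {1} × U₀}` (the conjugates `k⁻¹ u((0,δ),0) k` have trivial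
archimedean part, `toMixed_adelicVal_heisChart_finite`); criterion ★ `integral_heisChart_mem_schwartzBruhatAdele_of_contDiff` — with
the archimedean clause supplied by §2. [cite: Rogawski1990, §7.3 (pp. 96–97)] [cite: WeilBNT1967, Ch. VII §2, Def. 2 and Prop. 2] -/
theorem integral_kAverage_heisChart_mem_schwartzBruhatAdele (hc : c * c = 1) (μY : Measure (traceZeroAdele F E c))
    [μY.IsAddLeftInvariant] [SFinite μY] [IsFiniteMeasureOnCompacts μY] (hK : IsCompact (KU : Set (quasiSplit F E c 3).Adelic))
    (μK : Measure KU) [IsFiniteMeasure μK] (z₁ : (quasiSplit F E c 3).Adelic) {f : (quasiSplit F E c 3).Adelic → ℂ}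
    (hf : IsQuasiSplitTest F E c 3 f) :
    (fun x₀ : AdeleRing (𝓞 E) E => ∫ w, (∫ k, f ((k : (quasiSplit F E c 3).Adelic)⁻¹ * z₁ *
      (heisChart hc (x₀, w) : (quasiSplit F E c 3).Adelic) * k) ∂μK) ∂μY) ∈ Meyer.schwartzBruhatAdele E := by
  have hsm := contDiff_integral_integral_kAverage_heisChart hc μY hK μK z₁ hf
  obtain ⟨η₁, η₂, hη₁, hη₂, hfη⟩ := hf
  have hη : IsSmoothKernelGL 3 E (fun z => (η₁ z : ℂ) + (η₂ z : ℂ) * Complex.I) := isSmoothKernelGL_of_isTestFunctionGL_pair hη₁ hη₂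
  have hfc : HasCompactSupport f := by
    have h : f = (fun z => (η₁ z : ℂ) + (η₂ z : ℂ) * Complex.I) ∘ adelicVal F E c 3 _ := funext hfη
    rw [h]
    have hcl : IsClosed ((adelic F E c 3 ((StdForm.antidiagonal 3).over E) : Subgroup (GL (Fin 3) (AdeleRing (𝓞 E) E))) :
        Set (GL (Fin 3) (AdeleRing (𝓞 E) E))) := isClosed_unitaryGroupOfForm_conjAdele F E c _
    exact hη.hasCompactSupport.comp_isClosedEmbedding hcl.isClosedEmbedding_subtypeVal
  obtain ⟨U, hU, hηU⟩ := hη.exists_level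
  obtain ⟨U₀, hU₀o, -, rfl⟩ := hU
  -- the OPEN set `{v | π(v)_f ∈ U₀}` (for the tube lemma) and the LEVEL `{v | π v ∈ {1} × U₀}` (for the invariance)
  set Uo : Set (quasiSplit F E c 3).Adelic := {v | GLn.sndHom 3 E (adelicVal F E c 3 _ v) ∈ U₀} with hUo
  have hUoo : IsOpen Uo := hU₀o.preimage (GLn.continuous_sndHom.comp continuous_subtype_val)
  have hUo1 : (1 : (quasiSplit F E c 3).Adelic) ∈ Uo := by
    show GLn.sndHom 3 E (adelicVal F E c 3 _ 1) ∈ U₀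
    rw [map_one, map_one]
    exact U₀.one_mem
  set Ul : Set (quasiSplit F E c 3).Adelic := {v | adelicVal F E c 3 _ v ∈ U₀.map (GLn.ofFinite 3 E)} with hUl
  have hfU : ∀ g, ∀ v ∈ Ul, f (g * v) = f g := fun g v hv => by
    rw [hfη, hfη, map_mul]
    exact hηU _ hv _
  obtain ⟨S, hSc, hS⟩ := exists_isCompact_kAverage_ne_zero hK μK z₁ hfc
  obtain ⟨𝔫, -, h𝔫⟩ := exists_levelIdeal_forall_conj_heisChart_mem hc hK hUoo hUo1
  -- the conjugates `k⁻¹ u((0,δ),0) k`, `δ ∈ 𝔫𝒪̂_E`, `k ∈ K`, lie in the level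
  have h𝔫l : ∀ δ ∈ levelIdeal E 𝔫, ∀ k ∈ KU,
      k⁻¹ * (heisChart hc ((((0 : InfiniteAdeleRing E), δ) : AdeleRing (𝓞 E) E), (0 : traceZeroAdele F E c)) :
        (quasiSplit F E c 3).Adelic) * k ∈ Ul := by
    intro δ hδ k hk
    have hf' := h𝔫 δ hδ k hk
    show adelicVal F E c 3 _ (k⁻¹ * (heisChart hc ((((0 : InfiniteAdeleRing E), δ) : AdeleRing (𝓞 E) E), (0 : traceZeroAdele F E c)) :
        (quasiSplit F E c 3).Adelic) * k) ∈ U₀.map (GLn.ofFinite 3 E)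
    have hinf : GLn.toMixed 3 E (adelicVal F E c 3 _ (k⁻¹ *
        (heisChart hc ((((0 : InfiniteAdeleRing E), δ) : AdeleRing (𝓞 E) E), (0 : traceZeroAdele F E c)) : (quasiSplit F E c 3).Adelic) * k)) = 1 := by
      simp only [map_mul, map_inv, toMixed_adelicVal_heisChart_finite hc, mul_one, inv_mul_cancel]
    rw [Subgroup.mem_map]
    refine ⟨GLn.sndHom 3 E (adelicVal F E c 3 _ (k⁻¹ *
        (heisChart hc ((((0 : InfiniteAdeleRing E), δ) : AdeleRing (𝓞 E) E), (0 : traceZeroAdele F E c)) : (quasiSplit F E c 3).Adelic) * k)),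
      hf', ?_⟩
    have hX := GLn.ofInfinite_toMixed_mul_ofFinite_sndHom (adelicVal F E c 3 _ (k⁻¹ *
        (heisChart hc ((((0 : InfiniteAdeleRing E), δ) : AdeleRing (𝓞 E) E), (0 : traceZeroAdele F E c)) : (quasiSplit F E c 3).Adelic) * k))
    rw [hinf, map_one, one_mul] at hX
    exact hX
  refine integral_heisChart_mem_schwartzBruhatAdele_of_contDiff hc μY
    (φ := fun u : adelicUnipotent F E c 3 => ∫ k, f ((k : (quasiSplit F E c 3).Adelic)⁻¹ * z₁ * (u : (quasiSplit F E c 3).Adelic) * k) ∂μK)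
    hSc hS (isOpen_levelIdeal 𝔫) (isCompact_levelIdeal 𝔫) (fun δ hδ u => ?_) hsm
  show (∫ k, f ((k : (quasiSplit F E c 3).Adelic)⁻¹ * z₁ * ((u : (quasiSplit F E c 3).Adelic) *
      (heisChart hc ((((0 : InfiniteAdeleRing E), δ) : AdeleRing (𝓞 E) E), (0 : traceZeroAdele F E c)) : (quasiSplit F E c 3).Adelic)) * k) ∂μK) =
    ∫ k, f ((k : (quasiSplit F E c 3).Adelic)⁻¹ * z₁ * (u : (quasiSplit F E c 3).Adelic) * k) ∂μK
  exact kAverage_mul_eq_of_forall_conj_mem μK z₁ hfU (h𝔫l δ hδ) _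

/-- The same in the letters of the (E-T) ∕ (E) assembly of the unipotent term (`fK g := ∫ k, f (k⁻¹ g k) dμK`,
`ψ x := ∫ y′, fK (z₁ u(x, y′)) dμY`, i.e. the product bracketed as `k⁻¹ (z₁ u) k`): `ψ ∈ Meyer.schwartzBruhatAdele E`.
[cite: Rogawski1990, §7.3 (pp. 96–97)] -/
theorem integral_kAverage_heisChart_mem_schwartzBruhatAdele' (hc : c * c = 1) (μY : Measure (traceZeroAdele F E c))
    [μY.IsAddLeftInvariant] [SFinite μY] [IsFiniteMeasureOnCompacts μY] (hK : IsCompact (KU : Set (quasiSplit F E c 3).Adelic))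
    (μK : Measure KU) [IsFiniteMeasure μK] (z₁ : (quasiSplit F E c 3).Adelic) {f : (quasiSplit F E c 3).Adelic → ℂ}
    (hf : IsQuasiSplitTest F E c 3 f) :
    (fun x₀ : AdeleRing (𝓞 E) E => ∫ w, (∫ k, f ((k : (quasiSplit F E c 3).Adelic)⁻¹ *
      (z₁ * (heisChart hc (x₀, w) : (quasiSplit F E c 3).Adelic)) * k) ∂μK) ∂μY) ∈ Meyer.schwartzBruhatAdele E := by
  have h := integral_kAverage_heisChart_mem_schwartzBruhatAdele hc μY hK μK z₁ hf
  simp only [mul_assoc] at h ⊢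
  exact h

end Assembly

end UnitaryGroup

end Literature.NumberTheory.Automorphic
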